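import Literature.MathematicalPhysics.QuantumFieldTheory.Balaban1983to89.B9Thm33G0DivRFromDir
import Literature.MathematicalPhysics.QuantumFieldTheory.Balaban1983to89.B9DivViaGradLettersAtPins

/-!
# `Balaban1983to89.B9Thm33G0DivRAtPins` — [B9] Theorem 3.12 (pp. 421–423): THE DIVERGENCE-LEFT (3.44) MEMBER `D*_U G₀ ∇*_{U,μ}` (`Thm33G0DivR.h44Ds`, W-c face `hdiv`)
# AT THE N06 CERTIFICATE'S PINS — the schema lemma `B9Thm33G0DivRFromDir.h44Ds_of_h44m` with its three kinematic hypotheses DISCHARGED by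
# `B9DivViaGradLettersAtPins` at node00-def-Y's letters: every member, every `Reg335` configuration, every `ε > 0`

T. Bałaban, *Propagators for lattice gauge theories in a background field*, Commun. Math. Phys. **99** (1985) 389–434
[`Balaban1985BackgroundPropagators`, "B9"]; [4] = T. Bałaban, *Propagators and renormalization transformations for lattice gauge
theories. II*, Commun. Math. Phys. **96** (1984) 223–250 [`Balaban1984PropagatorsII`].

statement-level skeleton of published theorems with citation tags; proofs where landed; nothing here is a claim about the Yang–Mills
mass gap

THE POINT (cell `pub-ymgap`, node N06 [B9]; width seat w5, W-c face `hdiv`).  The member-level form the knit consumes in one term: at a member `x` of node00-def-Y's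
record, with the certificate's pin equations `hDvsco12 : 𝔬.Dvstar U = DvscoKH …`, `h𝔡Ad : Dd U = fun ν => coordOpK (trBasis N) (fun _ => cdBₗ … U ν)`, `hblk12 ∕ hblkW12`
(bond block map `blkBK bI`, site block map `blkSK (sIK bI)`), the input Hölder family pinned to `bHK … (bI x)` (`hbHXA`, taken here as the pin `hbHX`), `bI` 1-faithful (`hβ1`), and a `Reg335` configuration
(`SU(N)`-valued, so the link variables contract): the rows-19-DERIVED direction members `Thm33G0Dir … U` give the displayed field `hdiv.h44Ds μ ε` for EVERY `ε > 0`
with the constant `(d+1)·(cR39 (trBasis N)·e^{δ_J·rJ}·Bi (min ε 1)·c)` and any rate `ρ ≤ δ₀`, `ρ + σ ≤ δ_J` (so `ρ = δ₀` at `δ_J := δ₀ + σ`).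
* ★★★ `h44Ds_pins`.
KNIT (dag-n06-d): `hdiv`'s first field := `h44Ds_pins x (hβ1 x) hU (hbHXA x) hrow … (hblk12 x) (hblkW12 x) (hDvsco12 x U) (h𝔡Ad x U) (hG0C …Thm33G0Dir) μ ε hε`;
the second field `h44DsDv` is dag-n06-l g18's (`B9Thm313WholeDvHolderFromDds.h44DsDv_of_h44Ds`, which consumes this one).

HONEST SCOPE.  By-name composition of two landed helper files; nothing of [B9]'s propagator estimates asserted (`Thm33G0Dir` is rows 19's content, a HYPOTHESIS here;
per dag-n06-l g18's located note the flat-Hölder members are statements about `U` in small-gauge position); COUNT-NEUTRAL; N06 is NOT discharged; one finite lattice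
at a time; nothing continuum, nothing about the mass gap ∕ Clay.  Cell `pub-ymgap` (HUMAN RULING D-0062 ∕ D-0154), Track A node N06 [B9], width seat `pub-ymgap-dag-n06-w5`
(g0′), 2026-08-28.
-/

noncomputable section

namespace Literature.MathematicalPhysics.QuantumFieldTheory.Balaban1983to89.B9Thm33G0DivRAtPins

open scoped Matrix.Norms.L2Operator
open Node00 B6GlobalChartV1 B6KLevelCensusIndexV1
open B6Geom246MultiLevelTorus (geomT)
open B6Ineq2142KLevelV1 (β)
open B7Prop2SpecialUnitary (specialUnitaryUnits)
open B9PinMembersKLevelV1 (MemberY geo9Y bg9Y)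
open B9CoReadingCoordsTranspose (TrIdx trBasis)
open B9CoReadingCoords (XBK coordOpK cdBₗ blkBK)
open B9CoReadingCoordsS (XSK blkSK sIK)
open B9CoReadingCoordsInput (bHK)
open B9CoRealizesRelAtLetters (RelB)
open B9GeoNormsKLevelV1 (geo9K geo9K_dist_nonneg)
open B9GeoLemma21KLevelV1 (geo9Y_dist_triangle geo9Y_dist_comm geo9Y_len_pos)
open B9Thm39ReadingCoords (cR39 cR39_nonneg)
open B9Thm34Ext (toB6)
open B11SectG (HasMaj BlockNorm RowSum)
open B9Thm312Whole (Ops GeoOK)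
open B9Thm312WholeClasses (cNormR)
open B9RWSums343Holder (HolderProbes)
open B9Thm312WholeDir (Thm33G0Dir)
open Node00.OpsYSectDCoords (DvscoKH)
open B9GradViaDivLettersAtPins (rJ)
open B9DivViaGradLettersAtPins (JTcoKH DvscoKH_eq_sum hasMaj_JTcoKH_pins bHK_dom)
open B9Thm33G0DivRFromDir (h44Ds_of_h44m)

variable {d ℓ : ℕ} {hd : 1 ≤ d + 1} {hL : Odd (ℓ + 1) ∧ 1 < ℓ + 1} {b₀ b₁ : ℝ} {Mstar : ℕ} {N : ℕ} [NeZero N]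
variable [∀ x : MemberY d ℓ hd hL b₀ b₁ Mstar, Fintype (geo9Y x).Site]

/-- ★★★ **`hdiv.h44Ds` AT THE CERTIFICATE'S PINS — `D*_U G₀ ∇*_{U,μ}` OUT OF THE INPUT HÖLDER CLASS `bHK … ε` INTO `𝔠_W⁽⁰⁾`, EVERY MEMBER, EVERY `Reg335` `U`, EVERY `ε > 0`**,
from the rows-19-derived direction members `Thm33G0Dir` (HYPOTHESIS) by `h44Ds_of_h44m` with `hDs := DvscoKH_eq_sum`, `hJT := hasMaj_JTcoKH_pins`, `hdom := bHK_dom`: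
constant `(d+1)·(cR39 (trBasis N)·e^{δ_J·rJ}·Bi (min ε 1)·c)`, rate `ρ` (`0 ≤ ρ ≤ δ₀`, `ρ + σ ≤ δ_J`, `0 ≤ δ_J`).
[cite: Balaban1985BackgroundPropagators, Thm 3.3 (3.44) p.398 + p.398 (remark after (3.47)) + (3.8) p.392 + Thm 3.12 pp.421–423 + (3.35) p.396; Balaban1984PropagatorsII, (2.51)–(2.56) pp.232–233 + Lemma 2.1 (2.61) p.234] -/
theorem h44Ds_pins (x : MemberY d ℓ hd hL b₀ b₁ Mstar) [DecidableRel (RelB x.toKIdx)] {bI : FBondY x.toKIdx → IBondY x.toKIdx}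
    (hβ1 : ∀ f : FBondY x.toKIdx, (geomT x.D).dist (β x.hN x.D x.hk (bI f)) (blkV1 x.hN x.D f) ≤ 1)
    {Y Z PX PY : Type} [Fintype Y] [Fintype Z] [Fintype PX] [Fintype PY]
    {𝔬 : Ops (geo9Y x) (bg9Y (Matrix (Fin N) (Fin N) ℂ) (specialUnitaryUnits (Fin N)) x) (XBK (TrIdx N) x.toKIdx) Y Z (XSK (TrIdx N) x.toKIdx)}
    {𝔭 : HolderProbes (geo9Y x) (bg9Y (Matrix (Fin N) (Fin N) ℂ) (specialUnitaryUnits (Fin N)) x) (XBK (TrIdx N) x.toKIdx) Y PX PY}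
    {Dd Dds : (bg9Y (Matrix (Fin N) (Fin N) ℂ) (specialUnitaryUnits (Fin N)) x).Cfg → Fin (d + 1) → Module.End ℝ (XBK (TrIdx N) x.toKIdx → ℝ)}
    {H : Prop} {bHX : ℝ → BlockNorm (toB6 (geo9Y x) 1 H) (XBK (TrIdx N) x.toKIdx → ℝ)} {B₀ : ℝ} {Bh Bi : ℝ → ℝ} {Bi2 : ℝ → ℝ → ℝ}
    {δ₀ σ c ρ δJ c35 α₀ : ℝ} {U : (bg9Y (Matrix (Fin N) (Fin N) ℂ) (specialUnitaryUnits (Fin N)) x).Cfg}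
    (hU : (bg9Y (Matrix (Fin N) (Fin N) ℂ) (specialUnitaryUnits (Fin N)) x).Reg335 c35 α₀ U)
    (hbHX : bHX = fun ε => letI : Fintype (geo9K x.toKIdx).Site := (inferInstance : Fintype (geo9Y x).Site); bHK x.toKIdx bI ε)
    (hrow : RowSum (toB6 (geo9Y x) 1 H) σ c) (hc : 0 ≤ c) (hBi : ∀ ε, 0 < ε → ε ≤ 1 → 0 ≤ Bi ε)
    (hρ : 0 ≤ ρ) (hρ0 : ρ ≤ δ₀) (hδJ : 0 ≤ δJ) (hρJ : ρ + σ ≤ δJ)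
    (hblk : 𝔬.blk = blkBK x.toKIdx bI) (hblkW : 𝔬.blkW = blkSK x.toKIdx (sIK x.toKIdx bI))
    (hDvs : 𝔬.Dvstar U = DvscoKH x.toKIdx (trBasis N) (bg9Y (Matrix (Fin N) (Fin N) ℂ) (specialUnitaryUnits (Fin N)) x) (fun U => U) U)
    (hDd : Dd U = fun ν => coordOpK (trBasis N) (fun _ : Fin (d + 1) => cdBₗ x.toKIdx U ν))
    (hH0 : Thm33G0Dir 𝔬 𝔭 Dd Dds 1 H bHX B₀ Bh Bi Bi2 δ₀ U)
    (μ : Fin (d + 1)) (ε : ℝ) (hε : 0 < ε) :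
    HasMaj (bHX ε) (cNormR 1 H 𝔬.blkW (fun y => (geo9Y_len_pos x y).le) 0) (𝔬.Dvstar U ∘ₗ (𝔬.G0 U ∘ₗ Dds U μ))
      (fun a b => (Fintype.card (Fin (d + 1)) : ℝ) * (cR39 (trBasis N) * Real.exp (δJ * rJ d ℓ) * Bi (min ε 1) * c) *
        Real.exp (-(ρ * (geo9Y x).dist a b))) := by
  letI : Fintype (geo9K x.toKIdx).Site := (inferInstance : Fintype (geo9Y x).Site)
  subst hbHX
  have hG : GeoOK (geo9Y x) := ⟨geo9Y_dist_triangle x, geo9Y_dist_comm x, geo9K_dist_nonneg x.toKIdx, geo9Y_len_pos x⟩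
  have hCJ : 0 ≤ cR39 (trBasis N) * Real.exp (δJ * rJ d ℓ) := mul_nonneg (cR39_nonneg _) (Real.exp_nonneg _)
  have hDs : 𝔬.Dvstar U = ∑ ν : Fin (d + 1),
      JTcoKH x.toKIdx (trBasis N) (bg9Y (Matrix (Fin N) (Fin N) ℂ) (specialUnitaryUnits (Fin N)) x) (fun U => U) ν U ∘ₗ Dd U ν := by
    rw [hDvs, hDd]
    exact DvscoKH_eq_sum x.toKIdx (trBasis N) (bg9Y (Matrix (Fin N) (Fin N) ℂ) (specialUnitaryUnits (Fin N)) x) (fun U => U) U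
  have hJT : ∀ ν : Fin (d + 1), HasMaj (BlockNorm.ofBlocks (toB6 (geo9Y x) 1 H) 𝔬.blk) (cNormR 1 H 𝔬.blkW (fun y => (geo9Y_len_pos x y).le) 0)
      (JTcoKH x.toKIdx (trBasis N) (bg9Y (Matrix (Fin N) (Fin N) ℂ) (specialUnitaryUnits (Fin N)) x) (fun U => U) ν U)
      (fun a b => cR39 (trBasis N) * Real.exp (δJ * rJ d ℓ) * Real.exp (-(δJ * (geo9Y x).dist a b))) := by
    intro ν
    rw [hblk, hblkW]
    exact hasMaj_JTcoKH_pins x hβ1 hU hδJ (fun y => (geo9Y_len_pos x y).le) ν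
  exact h44Ds_of_h44m hG hrow (fun y => (geo9Y_len_pos x y).le) hBi hCJ hc hρ hρ0 hρJ hH0 hDs hJT (fun ε' hε' => bHK_dom x.toKIdx ε' hε') μ ε hε

end Literature.MathematicalPhysics.QuantumFieldTheory.Balaban1983to89.B9Thm33G0DivRAtPins

end
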